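import Summits.QuantumAdvantage.AdviceFreeQNC0.RegisterPathSum
import Summits.QuantumAdvantage.AdviceFreeQNC0.TwistBoundX3LocalProof
import HarnessLib

/-!
# Cell qa-qnc0, `p = 3` — planner qa-qnc0-p1 g39, ROUND-38 §6.4.3 / ask A39-7: PINNED letters in the register chain

The one new analytic point behind `SparseRead39.TwistBoundZConstPinned` (hence `(R1)₀` via the PROVED
`SparseRead39.r1Zero_of_pinned`): a PINNED letter `x_j = ξ` is the site operator `genOp (pinW ξ w)` whose weight vanishes
on the branch `b ≠ ξ`; at register radius `r = 0` the deterministic update `σ ↦ nextState σ ξ` is a BIJECTION of the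
6-point walk space (`nextState_lostBit_injective` with `lostBit σ b = b`), so

* `rnsq_genOp_pinW_zero_le` : `rnsq (genOp (pinW ξ w) g) ≤ rnsq g / 4` for weights of norm `≤ 1`, and
* `rnsq_genOp_pinW_zero_eq` : `= rnsq g / 4` exactly for unimodular weights —

i.e. the `ℓ²` norm drops by EXACTLY the factor `½` that the subcube normalisation `2^{N − #pins}` requires: pinned letters
cost nothing and gain nothing.  (At `r ≥ 1` the lost bit is a register bit, `σ ↦ nextState σ ξ` is 2-to-1 and only `1/√2`
survives — the constant-output chain must be set up at `r = 0`; recipe in ROUND-38 §6.4.3.)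

## v2 (21:25Z): the mixed chain

`SiteContracts ρ` (= the block lemma at `r = 0`, provided by `blockOpR_contracts 0`), `rnsq_chain_mixed_zero_le` and
`norm_sum_pathW_mixed_le`: a chain of generic (norm `≤ 1`), PINNED (`pinW`) and TWISTED-FREE (`signW ζ ε`, `ζ` a primitive cube
root) sites has `‖Σ_b pathW‖ ≤ √6 · ρ^{#twisted free} · 2^L / 2^{#pinned}`.

## v3 (21:40Z): **A39-7 PROVED** — `twistBoundZConstPinned : ∃ ρ, 0 ≤ ρ ∧ ρ < 1 ∧ TwistBoundZConstPinned ρ`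

`TwistBoundZConstPinned` is restated VERBATIM from `exp39/SparseRead39.lean` (HOME files cannot import each other; the
restatement is definitionally equal to SparseRead39's — checked by `Iff.rfl` against a verbatim copy in a scratch file, rc 0), so
together with the PROVED `SparseRead39.r1Zero_of_pinned : TwistBoundZConstPinned ρ → R1Zero ρ` this gives **(R1)₀ unconditionally**
(modulo porting both files into one import closure): every strategy measurable w.r.t. `x|_W`, `W ⊆ [N]` ARBITRARY, obeys
`‖Σ_x e₃(β·x)[OddZeros x ∧ Rel x (g x)]‖ ≤ A·ρ^{#(supp β ∖ W)}·2^N`.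
The proof (section `ConstOutputs`): (i) the walk-frame bell of constant outputs `b` is `y_g = b_g ⊕ x_g ⊕ x_{g+1}` (cyclic), which
the `r = 0` chain cannot evaluate at site `g`; RE-ASSOCIATING the win parity `Σ_g L_g y_g ≡ Σ_j [b_j L_j + x_j (L_j + L_{j−1})]`
(`sign_reassoc`, the cyclic term `L_{−1} = L_n = [κ + 2τ ≠ 0]` being constant on the resolved event `st u n = τ`) gives a per-LETTER
sign `epsZ` computable from the state before the letter (`liveCur`, `livePrev` via `st_{m−1} = st_m − 1 − [u_{m−1}]`); (ii) the
pointwise identity `pointwise_eqZ` (pins `pinF`, phases, signs with a master switch `on` for `Z` vs `S`, final vector `fZ` on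
`[−σ.1 = τ]`); (iii) `core_boundZ` = (ii) summed + `norm_sum_pathW_mixed_le` (pinned sites `< n` are `pinW`, twisted free sites are
`signW (phase γ m) _` with `phase ≠ 1`); (iv) `main_boundZ`: transport `x ↔ u` on the odd class (`rel_iff_ringWinU`, `sum_odd_eq_sum_u`),
`[WIN] = (Z − S)/2` (`winSign_eq_sum`, `sum_resolve_off`), three values of `τ`; (v) bookkeeping: `pin_prod_eq`, the site counts vs
letter counts (`card_free_twisted_le`, `card_pinned_le`: the last letter lives in the final vector, costing one factor `ρ` and one
factor `2`), `trivial_boundZ` for `N ≤ 2`, rate `ρ := max ρ₀ ½`, constant `A := 3√6/ρ + 4/ρ²`.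

Custody (D-0168 E1): experiment file under HOME, farm `lean check` only; nothing proposed; crux 22907 untouched.
PORT NOTE: namespace `BondTwist3` (tree) is extended here; `siteCnt` avoids the clash with the tree's `BondTwist3.cnt`
(`RegisterChainBlocks`); no `instance`, no `notation`.
-/

noncomputable section

namespace Summit.QuantumAdvantage.AdviceFreeQNC0

open Finset Literature.Computability.QuantumComplexity

namespace BondTwist3

variable {r : ℕ}

/-- The pinned weight: keep the branch `b = ξ` only. -/
def pinW (ξ : Bool) (w : RegState r → Bool → ℂ) : RegState r → Bool → ℂ :=
  fun σ b => if b = ξ then w σ b else 0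

/-- auxiliary lemma `norm_pinW_le` (planner p1 g39, exp39; ported verbatim). -/
theorem norm_pinW_le (ξ : Bool) (w : RegState r → Bool → ℂ) (hw : ∀ σ b, ‖w σ b‖ ≤ 1) (σ : RegState r) (b : Bool) :
    ‖pinW ξ w σ b‖ ≤ 1 := by
  unfold pinW; split_ifs
  · exact hw σ b
  · simp

/-- The pinned site operator is `½ · w(σ,ξ) · g(σ·ξ)`. -/
theorem genOp_pinW (ξ : Bool) (w : RegState r → Bool → ℂ) (g : RegState r → ℂ) (σ : RegState r) :
    genOp (pinW ξ w) g σ = w σ ξ * g (nextState σ ξ) / 2 := by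
  unfold genOp pinW
  cases ξ <;> simp

/-- At `r = 0` the lost bit is the letter itself. -/
theorem lostBit_zero (σ : RegState 0) (b : Bool) : lostBit σ b = b := by
  unfold lostBit; simp

/-- At `r = 0`, reading a FIXED letter is injective on the walk space. -/
theorem nextState_injective_zero (ξ : Bool) : Function.Injective fun σ : RegState 0 => nextState σ ξ := by
  intro σ σ' h
  have h2 := @nextState_lostBit_injective 0 (σ, ξ) (σ', ξ) (by
    show (nextState σ ξ, lostBit σ ξ) = (nextState σ' ξ, lostBit σ' ξ)
    rw [lostBit_zero, lostBit_zero]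
    exact Prod.ext (by simpa using h) rfl)
  simpa using congrArg Prod.fst h2

/-- … hence a bijection (finite type). -/
theorem nextState_bijective_zero (ξ : Bool) : Function.Bijective fun σ : RegState 0 => nextState σ ξ :=
  Finite.injective_iff_bijective.1 (nextState_injective_zero ξ)

/-- Re-indexing: `Σ_σ h(σ·ξ) = Σ_τ h(τ)` at `r = 0`. -/
theorem sum_nextState_zero (ξ : Bool) (h : RegState 0 → ℝ) :
    ∑ σ : RegState 0, h (nextState σ ξ) = ∑ τ : RegState 0, h τ :=
  Equiv.sum_comp (Equiv.ofBijective _ (nextState_bijective_zero ξ)) h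

/-- **Pinned letters at `r = 0` are exactly `½` in `ℓ²` (contraction form):** `rnsq (genOp (pinW ξ w) g) ≤ rnsq g / 4`. -/
theorem rnsq_genOp_pinW_zero_le (ξ : Bool) (w : RegState 0 → Bool → ℂ) (hw : ∀ σ b, ‖w σ b‖ ≤ 1)
    (g : RegState 0 → ℂ) : rnsq (genOp (pinW ξ w) g) ≤ rnsq g / 4 := by
  unfold rnsq
  have hpt : ∀ σ : RegState 0, ‖genOp (pinW ξ w) g σ‖ ^ 2 ≤ ‖g (nextState σ ξ)‖ ^ 2 / 4 := by
    intro σ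
    rw [genOp_pinW, norm_div, norm_mul, Complex.norm_ofNat, div_pow]
    have h1 : ‖w σ ξ‖ * ‖g (nextState σ ξ)‖ ≤ ‖g (nextState σ ξ)‖ :=
      mul_le_of_le_one_left (norm_nonneg _) (hw σ ξ)
    have h2 := pow_le_pow_left₀ (by positivity) h1 2
    have h4 : (0 : ℝ) < 2 ^ 2 := by norm_num
    calc (‖w σ ξ‖ * ‖g (nextState σ ξ)‖) ^ 2 / 2 ^ 2 ≤ ‖g (nextState σ ξ)‖ ^ 2 / 2 ^ 2 :=
          div_le_div_of_nonneg_right h2 h4.le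
      _ = ‖g (nextState σ ξ)‖ ^ 2 / 4 := by norm_num
  calc ∑ σ, ‖genOp (pinW ξ w) g σ‖ ^ 2 ≤ ∑ σ : RegState 0, ‖g (nextState σ ξ)‖ ^ 2 / 4 := sum_le_sum fun σ _ => hpt σ
    _ = (∑ τ : RegState 0, ‖g τ‖ ^ 2) / 4 := by
        rw [← sum_div, sum_nextState_zero ξ (fun τ => ‖g τ‖ ^ 2)]

/-- **… and exactly `½` for unimodular weights:** `rnsq (genOp (pinW ξ w) g) = rnsq g / 4`. -/
theorem rnsq_genOp_pinW_zero_eq (ξ : Bool) (w : RegState 0 → Bool → ℂ) (hw : ∀ σ, ‖w σ ξ‖ = 1)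
    (g : RegState 0 → ℂ) : rnsq (genOp (pinW ξ w) g) = rnsq g / 4 := by
  unfold rnsq
  have hpt : ∀ σ : RegState 0, ‖genOp (pinW ξ w) g σ‖ ^ 2 = ‖g (nextState σ ξ)‖ ^ 2 / 4 := by
    intro σ
    rw [genOp_pinW, norm_div, norm_mul, Complex.norm_ofNat, hw σ, one_mul, div_pow]
    norm_num
  rw [Finset.sum_congr rfl fun σ _ => hpt σ, ← sum_div, sum_nextState_zero ξ (fun τ => ‖g τ‖ ^ 2)]

/-- A chain of pinned site operators at `r = 0`: `rnsq` drops by `4^{-L}` (so `‖·‖` by `2^{-L}`), for any weights of norm `≤ 1`. -/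
theorem rnsq_chain_pinW_zero_le (ξ : ℕ → Bool) (W : ℕ → RegState 0 → Bool → ℂ) (hW : ∀ j σ b, ‖W j σ b‖ ≤ 1)
    (f : RegState 0 → ℂ) (i L : ℕ) :
    rnsq (chainFrom (fun j => pinW (ξ j) (W j)) f i L) ≤ rnsq f / 4 ^ L := by
  induction L generalizing i with
  | zero => simp [chainFrom]
  | succ L ih =>
    rw [chainFrom_succ]
    calc rnsq (genOp (pinW (ξ i) (W i)) (chainFrom (fun j => pinW (ξ j) (W j)) f (i + 1) L))
        ≤ rnsq (chainFrom (fun j => pinW (ξ j) (W j)) f (i + 1) L) / 4 :=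
          rnsq_genOp_pinW_zero_le (ξ i) (W i) (hW i) _
      _ ≤ (rnsq f / 4 ^ L) / 4 := div_le_div_of_nonneg_right (ih (i + 1)) (by norm_num)
      _ = rnsq f / 4 ^ (L + 1) := by rw [pow_succ, div_div]


/-! ## Mixed chains at `r = 0` (v2): the analytic half of A39-7

A site of the chain is PINNED (weight `pinW ξ w`, factor exactly `¼` in `rnsq`), TWISTED FREE (weight `signW ζ ε` with
`ζ³ = 1, ζ ≠ 1`: factor `ρ₀²` by the one-site block lemma `blockOpR_contracts 0`), or merely bounded (factor `≤ 1`).  Hence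
`rnsq (chain) ≤ ρ₀^{2·#twisted free} / 4^{#pinned} · rnsq f`, and by the path-sum identity `sum_pathW_eq` the letter sum over
`{0,1}^L` is at most `2^L · ρ₀^{#twisted free} / 2^{#pinned} · √(rnsq f)` — i.e. normalised by the size `2^{L − #pinned}` of the
pinned subcube, with the twist counted on the free letters only: exactly the shape of `SparseRead39.TwistBoundZConstPinned`.
What remains for A39-7 is the combinatorial identity `pathW = phase · sign · [odd] · [Rel]` for constant outputs (ROUND-38 §6.4.3). -/

/-- The hypothesis shape delivered by `blockOpR_contracts 0` (one-site blocks). -/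
def SiteContracts (ρ : ℝ) : Prop :=
  ∀ (ζ : ℂ), ζ ^ 3 = 1 → ζ ≠ 1 → ∀ (ω : Fin (2 * 0) → ℂ), (∀ j, ω j ^ 3 = 1) →
    ∀ (ε : Fin (2 * 0 + 1) → RegState 0 → Bool → Bool) (f : RegState 0 → ℂ), rnsq (blockOpR ζ ω ε f) ≤ ρ ^ 2 * rnsq f

/-- `blockOpR_contracts 0` provides some `ρ₀ ∈ [0,1)` with `SiteContracts ρ₀`. -/
theorem siteContracts_exists : ∃ ρ : ℝ, 0 ≤ ρ ∧ ρ < 1 ∧ SiteContracts ρ := blockOpR_contracts 0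

/-- At `r = 0` a block is one site: `blockOpR ζ ω ε f = siteOpR ζ (ε 0) f`. -/
theorem blockOpR_zero_eq (ζ : ℂ) (ω : Fin (2 * 0) → ℂ) (ε : Fin (2 * 0 + 1) → RegState 0 → Bool → Bool)
    (f : RegState 0 → ℂ) : blockOpR ζ ω ε f = siteOpR ζ (ε 0) f := rfl

/-- A twisted free site contracts by `ρ₀²` in `rnsq`. -/
theorem rnsq_genOp_signW_zero_le {ρ : ℝ} (hρ : SiteContracts ρ) (ζ : ℂ) (hζ : ζ ^ 3 = 1) (hζ1 : ζ ≠ 1)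
    (ε : RegState 0 → Bool → Bool) (g : RegState 0 → ℂ) :
    rnsq (genOp (signW ζ ε) g) ≤ ρ ^ 2 * rnsq g := by
  have h := hρ ζ hζ hζ1 (fun _ => 1) (fun _ => by simp) (fun _ => ε) g
  rw [blockOpR_zero_eq] at h
  rwa [genOp_sign]

/-- Number of sites `j ∈ [i, i+L)` satisfying `p`. -/
def siteCnt (p : ℕ → Prop) [DecidablePred p] (i L : ℕ) : ℕ := ∑ m ∈ range L, if p (i + m) then 1 else 0

/-- auxiliary lemma `siteCnt_zero` (planner p1 g39, exp39; ported verbatim). -/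
@[simp] theorem siteCnt_zero (p : ℕ → Prop) [DecidablePred p] (i : ℕ) : siteCnt p i 0 = 0 := by simp [siteCnt]

/-- auxiliary lemma `siteCnt_succ` (planner p1 g39, exp39; ported verbatim). -/
theorem siteCnt_succ (p : ℕ → Prop) [DecidablePred p] (i L : ℕ) :
    siteCnt p i (L + 1) = (if p i then 1 else 0) + siteCnt p (i + 1) L := by
  unfold siteCnt
  rw [Finset.sum_range_succ', add_zero, add_comm]
  congr 1
  refine Finset.sum_congr rfl fun m _ => ?_
  rw [show i + (m + 1) = i + 1 + m by omega]

/-- auxiliary lemma `siteCnt_le` (planner p1 g39, exp39; ported verbatim). -/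
theorem siteCnt_le (p : ℕ → Prop) [DecidablePred p] (i L : ℕ) : siteCnt p i L ≤ L := by
  unfold siteCnt
  calc ∑ m ∈ range L, (if p (i + m) then 1 else 0) ≤ ∑ _m ∈ range L, 1 :=
        Finset.sum_le_sum fun m _ => by split_ifs <;> omega
    _ = L := by simp

/-- **Mixed chain contraction at `r = 0`.**  With `pinned`, `twisted` arbitrary predicates on sites: pinned sites carry
`pinW` weights, twisted unpinned sites carry `signW ζ ε` weights with a non-trivial cube root `ζ`, all weights have norm
`≤ 1`; then `rnsq (chainFrom W f i L) ≤ ρ₀^{2·siteCnt(twisted ∧ ¬pinned)} / 4^{siteCnt pinned} · rnsq f`. -/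
theorem rnsq_chain_mixed_zero_le {ρ : ℝ} (hρ0 : 0 ≤ ρ) (hρ : SiteContracts ρ)
    (W : ℕ → RegState 0 → Bool → ℂ) (hW : ∀ j σ b, ‖W j σ b‖ ≤ 1)
    (pinned twisted : ℕ → Prop) [DecidablePred pinned] [DecidablePred twisted]
    (hpin : ∀ j, pinned j → ∃ (ξ : Bool) (w : RegState 0 → Bool → ℂ), (∀ σ b, ‖w σ b‖ ≤ 1) ∧ W j = pinW ξ w)
    (htw : ∀ j, twisted j → ¬ pinned j →
      ∃ (ζ : ℂ) (ε : RegState 0 → Bool → Bool), ζ ^ 3 = 1 ∧ ζ ≠ 1 ∧ W j = signW ζ ε)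
    (f : RegState 0 → ℂ) :
    ∀ L i : ℕ, rnsq (chainFrom W f i L)
      ≤ ρ ^ (2 * siteCnt (fun j => twisted j ∧ ¬ pinned j) i L) / 4 ^ (siteCnt pinned i L) * rnsq f
  | 0, i => by simp
  | L + 1, i => by
    rw [chainFrom_succ, siteCnt_succ, siteCnt_succ]
    set g := chainFrom W f (i + 1) L with hg
    set B : ℝ := ρ ^ (2 * siteCnt (fun j => twisted j ∧ ¬ pinned j) (i + 1) L) / 4 ^ (siteCnt pinned (i + 1) L) * rnsq f with hB
    have ih : rnsq g ≤ B := rnsq_chain_mixed_zero_le hρ0 hρ W hW pinned twisted hpin htw f L (i + 1)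
    have hBnn : 0 ≤ B := by rw [hB]; have := rnsq_nonneg f; positivity
    by_cases hp : pinned i
    · obtain ⟨ξ, w, hw, hWi⟩ := hpin i hp
      have hnt : ¬ (twisted i ∧ ¬ pinned i) := fun h => h.2 hp
      rw [if_pos hp, if_neg hnt, hWi]
      calc rnsq (genOp (pinW ξ w) g) ≤ rnsq g / 4 := rnsq_genOp_pinW_zero_le ξ w hw g
        _ ≤ B / 4 := div_le_div_of_nonneg_right ih (by norm_num)
        _ = ρ ^ (2 * (0 + siteCnt (fun j => twisted j ∧ ¬ pinned j) (i + 1) L)) / 4 ^ (1 + siteCnt pinned (i + 1) L) * rnsq f := by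
            rw [hB, zero_add, pow_add, pow_one]; ring
    · by_cases ht : twisted i
      · obtain ⟨ζ, ε, hζ, hζ1, hWi⟩ := htw i ht hp
        have htt : (twisted i ∧ ¬ pinned i) := ⟨ht, hp⟩
        rw [if_neg hp, if_pos htt, hWi]
        calc rnsq (genOp (signW ζ ε) g) ≤ ρ ^ 2 * rnsq g := rnsq_genOp_signW_zero_le hρ ζ hζ hζ1 ε g
          _ ≤ ρ ^ 2 * B := mul_le_mul_of_nonneg_left ih (by positivity)
          _ = ρ ^ (2 * (1 + siteCnt (fun j => twisted j ∧ ¬ pinned j) (i + 1) L)) / 4 ^ (0 + siteCnt pinned (i + 1) L) * rnsq f := by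
              rw [hB, zero_add, mul_add, mul_one, pow_add]; ring
      · have hnt : ¬ (twisted i ∧ ¬ pinned i) := fun h => ht h.1
        rw [if_neg hp, if_neg hnt, zero_add, zero_add]
        calc rnsq (genOp (W i) g) ≤ rnsq g := rnsq_genOp_le (W i) (hW i) g
          _ ≤ B := ih

/-- **The letter-sum form (path-sum identity + mixed contraction):** for `|f| ≤ 1` and any start state `σ`,
`‖Σ_{b ∈ {0,1}^L} pathW W f 0 σ L b‖ ≤ √6 · ρ₀^{#twisted free} · 2^L / 2^{#pinned}` — the bound is `√6 · ρ₀^{#twisted free}`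
times the size `2^{L − #pinned}` of the pinned subcube. -/
theorem norm_sum_pathW_mixed_le {ρ : ℝ} (hρ0 : 0 ≤ ρ) (hρ : SiteContracts ρ)
    (W : ℕ → RegState 0 → Bool → ℂ) (hW : ∀ j σ b, ‖W j σ b‖ ≤ 1)
    (pinned twisted : ℕ → Prop) [DecidablePred pinned] [DecidablePred twisted]
    (hpin : ∀ j, pinned j → ∃ (ξ : Bool) (w : RegState 0 → Bool → ℂ), (∀ σ b, ‖w σ b‖ ≤ 1) ∧ W j = pinW ξ w)
    (htw : ∀ j, twisted j → ¬ pinned j →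
      ∃ (ζ : ℂ) (ε : RegState 0 → Bool → Bool), ζ ^ 3 = 1 ∧ ζ ≠ 1 ∧ W j = signW ζ ε)
    (f : RegState 0 → ℂ) (hf : ∀ τ, ‖f τ‖ ≤ 1) (σ : RegState 0) (L i : ℕ) :
    ‖∑ b : Fin L → Bool, pathW W f i σ L (extB b)‖
      ≤ Real.sqrt 6 * ρ ^ (siteCnt (fun j => twisted j ∧ ¬ pinned j) i L) * (2 : ℝ) ^ L / (2 : ℝ) ^ (siteCnt pinned i L) := by
  set t := siteCnt (fun j => twisted j ∧ ¬ pinned j) i L with ht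
  set p := siteCnt pinned i L with hp
  rw [sum_pathW_eq, norm_mul, norm_pow, Complex.norm_ofNat]
  -- the chain value at σ
  have hc2 : ‖chainFrom W f i L σ‖ ^ 2 ≤ ρ ^ (2 * t) / 4 ^ p * 6 := by
    refine (norm_sq_le_rnsq _ σ).trans ?_
    refine (rnsq_chain_mixed_zero_le hρ0 hρ W hW pinned twisted hpin htw f L i).trans ?_
    have h6 : rnsq f ≤ 6 := by
      have h := rnsq_le_card f hf
      rw [card_regState] at h
      simpa using h
    exact mul_le_mul_of_nonneg_left h6 (by positivity)
  have hD : ρ ^ (2 * t) / 4 ^ p * 6 = (Real.sqrt 6 * ρ ^ t / (2 : ℝ) ^ p) ^ 2 := by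
    rw [div_pow, mul_pow, Real.sq_sqrt (by norm_num : (0 : ℝ) ≤ 6), ← pow_mul, mul_comm t 2]
    have h4 : ((2 : ℝ) ^ p) ^ 2 = 4 ^ p := by
      rw [← pow_mul, mul_comm, pow_mul]; norm_num
    rw [h4]; ring
  rw [hD] at hc2
  have hc : ‖chainFrom W f i L σ‖ ≤ Real.sqrt 6 * ρ ^ t / (2 : ℝ) ^ p :=
    (pow_le_pow_iff_left₀ (norm_nonneg _) (by positivity) (by norm_num : (2 : ℕ) ≠ 0)).1 hc2
  calc (2 : ℝ) ^ L * ‖chainFrom W f i L σ‖ ≤ (2 : ℝ) ^ L * (Real.sqrt 6 * ρ ^ t / (2 : ℝ) ^ p) :=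
        mul_le_mul_of_nonneg_left hc (by positivity)
    _ = Real.sqrt 6 * ρ ^ t * (2 : ℝ) ^ L / (2 : ℝ) ^ p := by ring


/-! ## Constant outputs on the `r = 0` chain (v3): the site sign and THE POINTWISE IDENTITY

For constant outputs `b` the walk-frame bell is `y_g = b_g ⊕ tGuess(x)_g = b_g ⊕ x_g ⊕ x_{g+1}` (cyclic), which the `r = 0` chain cannot
evaluate at site `g` (`MidSpec` fails).  Re-associating the win parity,
`Σ_g L_g·y_g = Σ_g L_g b_g + Σ_j x_j (L_j + L_{j−1})` (indices mod `n+1`), gives a per-LETTER sign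
`c_j = (b_j ∧ L_j) ⊕ (x_j ∧ (L_j ⊕ L_{j−1}))` computable from the state before letter `j` (position `−st u j`, spin `u_{j−1}`)
and the letter; the cyclic term `L_{−1} = L_n` is the constant `[κ + 2τ ≠ 0]` on the resolved event `st u n = τ`. -/

end BondTwist3

end Summit.QuantumAdvantage.AdviceFreeQNC0
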